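import Summits.BirchSwinnertonDyer.BirchSwinnertonDyer.Theorems.ErratumRoadFiveSelmerDefectMixedPlaces
import Summits.BirchSwinnertonDyer.BirchSwinnertonDyer.Theorems.ErratumRoadFiveLocalInvariantsTransfer
import HarnessLib

/-!
# Route `ErratumRoadFive` (K2, `p ≥ 5`), crux (T) `Rest3TorsionBranchAtFive` (item
# stmt-BirchSwinnertonDyer-19702): THEOREM T♭ at the Selmer level in the MIXED-PLACES currency — one
# bounded constrained place `v₀` (`𝔭`-decomposition) plus divisible constrained places (inertia indices),
# i.e. the shape of `BigGaloisRepSelmer.selmerBig κ ρ 𝔮 Σ = selmer (localMap K) (strictSet p 𝔮 Σ) …`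

Cell `bsd-stepL` (run/shared/lean/pub/bsd-stepL/), seat `bsd-stepL-bdp` (prover g15, 2026-08-27), memo
`HOME/proof/PROOF-BDP.md` §33.10; `--supports stmt-BirchSwinnertonDyer-19702 --as helper`.

* `mul_fittingIdeal_le_of_selmer_congruences_boundedDefect_mixed` — the `μ`-free core
  (`SelmerDefectAssemblySigma.mul_fittingIdeal_le_…`) for a general constrained set `L₀ ∋ v₀`: local
  invariants of `M_{g_m}` killed by `π^k` at `v₀` and `a`-DIVISIBLE at every other `v ∈ L₀`
  (`SelmerDefectMixedPlaces.smul_mem_map_selmer_pow_of_local`);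
* `charIdeal_le_of_selmer_congruences_finite_localInvariants_mixed_imprimitive` — Σ-inserted end form with
  (G2) discharged by `SelmerDefectMixedPlaces.exists_fin_span_dual_defect_mixed`;
* `charIdeal_le_of_selmer_congruences_fLocal_printed_mixed` — the same with the `μ = 0` input in PRINTED
  shape ((7′), `MuTransfer`) and LOCAL DATA FOR `f` ONLY at `v₀` (`LocalInvariantsTransfer`, re-indexed
  family `m ↦ g_{m+j+1}`); divisibility at the other constrained places stays a hypothesis on the `M_{g_m}`
  (at an inertia index of an unramified place it is `a`-divisibility of `M_{g_m}` itself).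

HONEST FRAMING: theorems only (no definition, no named fact, no `sorry`); PURE ALGEBRA on abstract Selmer
data; objects are NOT constructed or asserted; nothing is booked; no census word, tier or label moves (T7).
References: [Castella2018Erratum] Lemma 2.1, proof of Thm. 1.1 (p. 4); memo PROOF-BDP §31.2–31.3, §33.
-/

set_option autoImplicit false
-- the Theorems namespace of this sub repeats the summit name by design (D-0017 nested layout)
set_option linter.dupNamespace false

noncomputable section

open CategoryTheory CharacterModule Literature.NumberTheory.GaloisRepresentations
  Literature.RingTheory.FittingIdeal Literature.NumberTheory.EllipticCurves
  Literature.NumberTheory.EllipticCurves.Module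
  Summit.BirchSwinnertonDyer.Rank1Residual.X11b.TorsionControl
  Summit.BirchSwinnertonDyer.Rank1Residual.X11b
  Summit.BirchSwinnertonDyer.Rank1Residual.X11b.CongruenceLimit
  Summit.BirchSwinnertonDyer.BirchSwinnertonDyer.Theorems.SelmerControlDefect
  Summit.BirchSwinnertonDyer.BirchSwinnertonDyer.Theorems.PontryaginDefect
  Summit.BirchSwinnertonDyer.BirchSwinnertonDyer.Theorems.SelmerDefectAssembly
  Summit.BirchSwinnertonDyer.BirchSwinnertonDyer.Theorems.SelmerDefectGenerators
  Summit.BirchSwinnertonDyer.BirchSwinnertonDyer.Theorems.SelmerDefectMixedPlaces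
  Summit.BirchSwinnertonDyer.BirchSwinnertonDyer.Theorems.SelmerDefectAssemblySigma
  Summit.BirchSwinnertonDyer.BirchSwinnertonDyer.Theorems.LocalInvariantsTransfer
open scoped ContRepresentation

namespace Summit.BirchSwinnertonDyer.BirchSwinnertonDyer.Theorems.SelmerDefectAssemblyMixed

open Summit.BirchSwinnertonDyer.BirchSwinnertonDyer.Theorems.BoundedCongruenceLimit
  Summit.BirchSwinnertonDyer.BirchSwinnertonDyer.Theorems.MuTransfer

variable {𝒪 : Type} [CommRing 𝒪] [IsDomain 𝒪] [IsDiscreteValuationRing 𝒪]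
  [IsAdicComplete (IsLocalRing.maximalIdeal 𝒪) 𝒪] [TopologicalSpace (PowerSeries 𝒪)]
variable {Γ₀ : Type} [Group Γ₀] [TopologicalSpace Γ₀] [IsTopologicalGroup Γ₀]
variable {ι₀ : Type*} {Γw : ι₀ → Type} [∀ v, Group (Γw v)] [∀ v, TopologicalSpace (Γw v)]
  [∀ v, IsTopologicalGroup (Γw v)] (ψ : ∀ v, Γw v →ₜ* Γ₀) (L₀ : Set ι₀) (v₀ : ι₀)

omit [IsAdicComplete (IsLocalRing.maximalIdeal 𝒪) 𝒪] in
/-- **The `μ`-free core with MIXED constrained places**: as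
`SelmerDefectAssemblySigma.mul_fittingIdeal_le_of_selmer_congruences_boundedDefect`, the local hypothesis
being: at `v₀`, `π^k` kills `M_{g_m}^{Γ_{v₀}}`; at every other constrained `v`, `M_{g_m}^{Γ_v}` is
`a`-divisible (inertia indices). Conclusion `(π^{kn})·Fitt_Λ(Sel(M_f)^∨) ⊆ (L^Σ)`.
[cite: Castella2018Erratum, proof of Thm. 1.1 (p. 4), read one-sidedly and without (iv)] -/
theorem mul_fittingIdeal_le_of_selmer_congruences_boundedDefect_mixed
    (a : PowerSeries 𝒪) (ha : Ideal.span {a} ≤ (⊥ : Ideal (PowerSeries 𝒪)).jacobson)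
    {Mf : Type} [AddCommGroup Mf] [Module (PowerSeries 𝒪) Mf] [TopologicalSpace Mf]
    [DiscreteTopology Mf] [ContinuousSMul (PowerSeries 𝒪) Mf] (ρf : ContinuousRep Γ₀ (PowerSeries 𝒪) Mf)
    (hdivf : Function.Surjective fun x : Mf => a • x) (h0f : ρf.toTopRep.ρ.invariants = ⊥)
    (Mg : ℕ → Type) [∀ m, AddCommGroup (Mg m)] [∀ m, Module (PowerSeries 𝒪) (Mg m)]
    [∀ m, TopologicalSpace (Mg m)] [∀ m, DiscreteTopology (Mg m)]
    [∀ m, ContinuousSMul (PowerSeries 𝒪) (Mg m)] (ρg : ∀ m, ContinuousRep Γ₀ (PowerSeries 𝒪) (Mg m))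
    (hdivg : ∀ m, Function.Surjective fun x : Mg m => a • x)
    (h0g : ∀ m, (ρg m).toTopRep.ρ.invariants = ⊥)
    (θ : ∀ m, 1 ≤ m → ((torsionRep (ρg m) (a ^ m)).toTopRep ≅ (torsionRep ρf (a ^ m)).toTopRep))
    [Module.Finite (PowerSeries 𝒪) (CharacterModule (selmer ψ L₀ ρf))]
    [∀ m, Module.Finite (PowerSeries 𝒪) (CharacterModule (selmer ψ L₀ (ρg m)))]
    {LS : PowerSeries 𝒪} (π : PowerSeries 𝒪) (k n : ℕ) (Lm : ℕ → PowerSeries 𝒪)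
    (hkillg : ∀ m, ∀ w : Mg m, w ∈ (((ρg m).restrict (ψ v₀)).toTopRep).ρ.invariants → π ^ k • w = 0)
    (hdivL : ∀ m, ∀ v ∈ L₀, v ≠ v₀ → ∀ w : Mg m, w ∈ (((ρg m).restrict (ψ v)).toTopRep).ρ.invariants →
      ∃ w' ∈ (((ρg m).restrict (ψ v)).toTopRep).ρ.invariants, a • w' = w)
    (hgen : ∀ m, 1 ≤ m → ∃ κ : Fin n → CharacterModule
      (↥(Submodule.torsionBy (PowerSeries 𝒪) ↥(selmer ψ L₀ (ρg m)) (a ^ m)) ⧸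
        Submodule.comap ((selmer ψ L₀ (ρg m)).subtype ∘ₗ
            (Submodule.torsionBy (PowerSeries 𝒪) ↥(selmer ψ L₀ (ρg m)) (a ^ m)).subtype)
          (Submodule.map (torsionInclH1 (ρg m) (a ^ m)) (selmer ψ L₀ (torsionRep (ρg m) (a ^ m))))),
      Submodule.span (PowerSeries 𝒪) (Set.range κ) = ⊤)
    (hCh : ∀ m, 1 ≤ m → Module.IsTorsion (PowerSeries 𝒪) (CharacterModule (selmer ψ L₀ (ρg m))) →
      charIdeal (PowerSeries 𝒪) (CharacterModule (selmer ψ L₀ (ρg m))) ≤ Ideal.span {Lm m})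
    (hc : ∀ m, 1 ≤ m →
      Ideal.span {Lm m} ⊔ (Ideal.span {a}) ^ m = Ideal.span {LS} ⊔ (Ideal.span {a}) ^ m) :
    Ideal.span {π ^ (k * n)} * Module.fittingIdeal (PowerSeries 𝒪) (CharacterModule (selmer ψ L₀ ρf)) 0 ≤
      Ideal.span {LS} := by
  classical
  -- f-side
  let jf : ∀ m : ℕ, ↥(selmer ψ L₀ (torsionRep ρf (a ^ m))) →ₗ[PowerSeries 𝒪] ↥(selmer ψ L₀ ρf) :=
    fun m => LinearMap.codRestrict (selmer ψ L₀ ρf)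
      ((torsionInclH1 ρf (a ^ m)).domRestrict (selmer ψ L₀ (torsionRep ρf (a ^ m))))
      fun x => cohomologyMap_mem_selmer ψ L₀ (torsionIncl ρf (a ^ m)) x.2
  have hjf : ∀ m, Function.Injective (jf m) := by
    intro m x x' h
    have h1 := congrArg Subtype.val h
    exact Subtype.ext (cohomologyMap_torsionIncl_injective ρf (a ^ m) (surjective_pow_smul a hdivf m)
      (invariants_divisible_of_eq_bot ρf (a ^ m) h0f) h1)
  haveI : ∀ m, Module.Finite (PowerSeries 𝒪) (CharacterModule ↥(selmer ψ L₀ (torsionRep ρf (a ^ m)))) :=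
    fun m => Module.Finite.of_surjective (dual (jf m)) (dual_surjective_of_injective (jf m) (hjf m))
  -- g-side
  let Sg : ∀ m : ℕ, Submodule (PowerSeries 𝒪) ↥(selmer ψ L₀ (ρg m)) :=
    fun m => Submodule.torsionBy (PowerSeries 𝒪) ↥(selmer ψ L₀ (ρg m)) (a ^ m)
  let jg : ∀ m : ℕ, ↥(selmer ψ L₀ (torsionRep (ρg m) (a ^ m))) →ₗ[PowerSeries 𝒪] ↥(Sg m) :=
    fun m => LinearMap.codRestrict (Sg m)
      (LinearMap.codRestrict (selmer ψ L₀ (ρg m))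
        ((torsionInclH1 (ρg m) (a ^ m)).domRestrict (selmer ψ L₀ (torsionRep (ρg m) (a ^ m))))
        fun x => cohomologyMap_mem_selmer ψ L₀ (torsionIncl (ρg m) (a ^ m)) x.2)
      fun x => (Submodule.mem_torsionBy_iff (a ^ m) _).2
        (Subtype.ext (smul_cohomologyMap_torsionIncl (ρg m) (a ^ m) x.1))
  have hjg : ∀ m, Function.Injective (jg m) := by
    intro m x x' h
    have h1 : (((jg m x : ↥(Sg m)) : ↥(selmer ψ L₀ (ρg m))) : continuousCohomology 1 (ρg m).toTopRep) =
        (((jg m x' : ↥(Sg m)) : ↥(selmer ψ L₀ (ρg m))) : continuousCohomology 1 (ρg m).toTopRep) := by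
      rw [h]
    exact Subtype.ext (cohomologyMap_torsionIncl_injective (ρg m) (a ^ m) (surjective_pow_smul a (hdivg m) m)
      (invariants_divisible_of_eq_bot (ρg m) (a ^ m) (h0g m)) h1)
  let U : ∀ m : ℕ, Submodule (PowerSeries 𝒪) ↥(Sg m) := fun m =>
    Submodule.comap ((selmer ψ L₀ (ρg m)).subtype ∘ₗ (Sg m).subtype)
      (Submodule.map (torsionInclH1 (ρg m) (a ^ m)) (selmer ψ L₀ (torsionRep (ρg m) (a ^ m))))
  have hU : ∀ m, LinearMap.range (jg m) = U m := by
    intro m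
    ext s
    constructor
    · rintro ⟨x, rfl⟩
      exact ⟨x, x.2, rfl⟩
    · rintro ⟨x, hx, hxs⟩
      refine ⟨⟨x, hx⟩, Subtype.ext (Subtype.ext ?_)⟩
      exact hxs
  -- the dual defect is killed by `π^k`: MIXED local hypothesis (bounded at `v₀`, divisible elsewhere)
  have hkill : ∀ m, 1 ≤ m → π ^ k ∈ Module.annihilator (PowerSeries 𝒪)
      (CharacterModule (↥(Sg m) ⧸ U m)) := by
    intro m _
    refine mem_annihilator_characterModule_of_forall_smul_eq_zero (π ^ k) fun q => ?_
    obtain ⟨s, rfl⟩ := Submodule.mkQ_surjective (U m) q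
    rw [← map_smul, Submodule.mkQ_apply, Submodule.Quotient.mk_eq_zero]
    have hs : (a ^ m) • ((s : ↥(selmer ψ L₀ (ρg m))) : continuousCohomology 1 (ρg m).toTopRep) = 0 := by
      have := (Submodule.mem_torsionBy_iff (a ^ m) (s : ↥(selmer ψ L₀ (ρg m)))).1 s.2
      exact congrArg Subtype.val this
    refine smul_mem_map_selmer_pow_of_local ψ L₀ (ρg m) a (hdivg m) (π ^ k) (fun v hv => ?_) m
      (s : ↥(selmer ψ L₀ (ρg m))).2 hs
    by_cases hv₀ : v = v₀
    · subst hv₀; exact Or.inl (hkillg m)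
    · exact Or.inr (hdivL m v hv hv₀)
  let eS : ∀ m : ℕ, ((CharacterModule ↥(selmer ψ L₀ (ρg m)) ⧸
      (Ideal.span {a}) ^ m • (⊤ : Submodule (PowerSeries 𝒪) (CharacterModule ↥(selmer ψ L₀ (ρg m))))) ≃ₗ[PowerSeries 𝒪]
        CharacterModule ↥(Sg m)) :=
    fun m => Classical.choice (PontryaginCongruence.nonempty_quotIdealPow_equiv_dual_torsionBy a m)
  let eP : ∀ m : ℕ, 1 ≤ m → (CharacterModule ↥(selmer ψ L₀ (torsionRep (ρg m) (a ^ m))) ≃ₗ[PowerSeries 𝒪]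
      CharacterModule ↥(selmer ψ L₀ (torsionRep ρf (a ^ m)))) :=
    fun m hm => CharacterModule.congr (selmerCongr ψ L₀ (θ m hm))
  refine mul_fittingIdeal_le_span_of_congruences (Ideal.span {a}) (Ideal.span {π ^ (k * n)})
    (fun m => CharacterModule ↥(selmer ψ L₀ (ρg m)))
    (fun m => CharacterModule ↥(selmer ψ L₀ (torsionRep ρf (a ^ m))))
    Lm ha (fun m _ => dual (jf m)) (fun m _ => dual_surjective_of_injective (jf m) (hjf m))
    (fun m hm => ?_) (fun m hm => fittingIdeal_zero_le_of_charIdeal_le (hCh m hm)) hc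
  rw [pow_mul]
  exact defect_le_sup_of_boundedKernel (Ideal.span {a}) m
    (((eS m).symm : _ →ₗ[PowerSeries 𝒪] _) ∘ₗ dual (U m).mkQ)
    (((eP m hm) : _ →ₗ[PowerSeries 𝒪] _) ∘ₗ dual (jg m) ∘ₗ ((eS m) : _ →ₗ[PowerSeries 𝒪] _))
    (exact_dual_conj_of_eq (jg m) (U m) (hU m) (eS m) (eP m hm))
    (dual_conj_surjective (jg m) (hjg m) (eS m) (eP m hm)) (hgen m hm) (hkill m hm)

/-- An `a`-divisible submodule is `a^m`-divisible (used for the local invariants at the divisible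
constrained places). [folklore] -/
theorem pow_divisible {R N : Type*} [CommSemiring R] [AddCommMonoid N] [Module R N] (S : Submodule R N)
    (a : R) (hdiv : ∀ w ∈ S, ∃ w' ∈ S, a • w' = w) (m : ℕ) : ∀ w ∈ S, ∃ w' ∈ S, a ^ m • w' = w := by
  induction m with
  | zero => intro w hw; exact ⟨w, hw, by rw [pow_zero, one_smul]⟩
  | succ m ih =>
    intro w hw
    obtain ⟨w₁, hw₁, h₁⟩ := hdiv w hw
    obtain ⟨w₂, hw₂, h₂⟩ := ih w₁ hw₁
    exact ⟨w₂, hw₂, by rw [pow_succ', mul_smul, h₂, h₁]⟩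

/-- **THEOREM T♭ at the Selmer level, MIXED places, Σ-inserted, (G2) discharged**: bounded place `v₀ ∈ L₀`
(`M_{g_m}^{Γ_{v₀}}` finite of order `≤ B`, killed by `π^k`), `a`-divisible local invariants at the other
constrained places, congruence with `L^Σ`, Σ-removal data, primitive `π ∤ L` ⟹ **`Ch_Λ(X₀) ⊆ (L)`**.
[cite: Castella2018Erratum, proof of Thm. 1.1 (p. 4), read one-sidedly and without (iv)] -/
theorem charIdeal_le_of_selmer_congruences_finite_localInvariants_mixed_imprimitive (hv₀ : v₀ ∈ L₀)
    (a : PowerSeries 𝒪) (ha : Ideal.span {a} ≤ (⊥ : Ideal (PowerSeries 𝒪)).jacobson)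
    {Mf : Type} [AddCommGroup Mf] [Module (PowerSeries 𝒪) Mf] [TopologicalSpace Mf]
    [DiscreteTopology Mf] [ContinuousSMul (PowerSeries 𝒪) Mf] (ρf : ContinuousRep Γ₀ (PowerSeries 𝒪) Mf)
    (hdivf : Function.Surjective fun x : Mf => a • x) (h0f : ρf.toTopRep.ρ.invariants = ⊥)
    (Mg : ℕ → Type) [∀ m, AddCommGroup (Mg m)] [∀ m, Module (PowerSeries 𝒪) (Mg m)]
    [∀ m, TopologicalSpace (Mg m)] [∀ m, DiscreteTopology (Mg m)]
    [∀ m, ContinuousSMul (PowerSeries 𝒪) (Mg m)] (ρg : ∀ m, ContinuousRep Γ₀ (PowerSeries 𝒪) (Mg m))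
    (hdivg : ∀ m, Function.Surjective fun x : Mg m => a • x)
    (h0g : ∀ m, (ρg m).toTopRep.ρ.invariants = ⊥)
    (θ : ∀ m, 1 ≤ m → ((torsionRep (ρg m) (a ^ m)).toTopRep ≅ (torsionRep ρf (a ^ m)).toTopRep))
    [Module.Finite (PowerSeries 𝒪) (CharacterModule (selmer ψ L₀ ρf))]
    [∀ m, Module.Finite (PowerSeries 𝒪) (CharacterModule (selmer ψ L₀ (ρg m)))]
    [∀ m, Finite (((ρg m).restrict (ψ v₀)).toTopRep).ρ.invariants]
    {M₀ : Type} [AddCommGroup M₀] [Module (PowerSeries 𝒪) M₀] [Module.Finite (PowerSeries 𝒪) M₀]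
    {π L LS P : PowerSeries 𝒪} (hπ : Prime π) (hL : ¬ π ∣ L) (hLS : LS = L * P) (hP : P ≠ 0)
    (k B : ℕ) (Lm : ℕ → PowerSeries 𝒪)
    (hkillg : ∀ m, ∀ w : Mg m, w ∈ (((ρg m).restrict (ψ v₀)).toTopRep).ρ.invariants → π ^ k • w = 0)
    (hdivL : ∀ m, ∀ v ∈ L₀, v ≠ v₀ → ∀ w : Mg m, w ∈ (((ρg m).restrict (ψ v)).toTopRep).ρ.invariants →
      ∃ w' ∈ (((ρg m).restrict (ψ v)).toTopRep).ρ.invariants, a • w' = w)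
    (hB : ∀ m, Nat.card (((ρg m).restrict (ψ v₀)).toTopRep).ρ.invariants ≤ B)
    (hCh : ∀ m, 1 ≤ m → Module.IsTorsion (PowerSeries 𝒪) (CharacterModule (selmer ψ L₀ (ρg m))) →
      charIdeal (PowerSeries 𝒪) (CharacterModule (selmer ψ L₀ (ρg m))) ≤ Ideal.span {Lm m})
    (hc : ∀ m, 1 ≤ m →
      Ideal.span {Lm m} ⊔ (Ideal.span {a}) ^ m = Ideal.span {LS} ⊔ (Ideal.span {a}) ^ m)
    (hTS : Module.IsTorsion (PowerSeries 𝒪) (CharacterModule (selmer ψ L₀ ρf)))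
    (hnfS : ∀ N' : Submodule (PowerSeries 𝒪) (CharacterModule (selmer ψ L₀ ρf)),
      Module.length (PowerSeries 𝒪) N' ≠ ⊤ → N' = ⊥)
    (hT₀ : Module.IsTorsion (PowerSeries 𝒪) M₀)
    (hnf₀ : ∀ N' : Submodule (PowerSeries 𝒪) M₀, Module.length (PowerSeries 𝒪) N' ≠ ⊤ → N' = ⊥)
    (hSig : charIdeal (PowerSeries 𝒪) M₀ * Ideal.span {P} ≤
      charIdeal (PowerSeries 𝒪) (CharacterModule (selmer ψ L₀ ρf))) :
    charIdeal (PowerSeries 𝒪) M₀ ≤ Ideal.span {L} :=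
  charIdeal_le_span_of_mul_fittingIdeal_le_imprimitive hπ hL hLS hP (k * B)
    (mul_fittingIdeal_le_of_selmer_congruences_boundedDefect_mixed ψ L₀ v₀ a ha ρf hdivf h0f Mg ρg hdivg
      h0g θ π k B Lm hkillg hdivL
      (fun m _ => exists_fin_span_dual_defect_mixed ψ L₀ (ρg m) (a ^ m) v₀ hv₀
        (surjective_pow_smul a (hdivg m) m) (h0g m)
        (fun v hv hne => pow_divisible _ a (hdivL m v hv hne) m) (hB m))
      hCh hc)
    hTS hnfS hT₀ hnf₀ hSig

/-- **THEOREM T♭ at the Selmer level, MIXED places, with the `μ = 0` input in PRINTED shape ((7′)) and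
LOCAL DATA FOR `f` ONLY at `v₀`** — the form composable with `BigGaloisRepSelmer.selmerBig`
(`L₀ = strictSet p 𝔮 Σ`, `v₀ =` the decomposition index at `𝔮`): `M_f^{Γ_{v₀}}` finite of order `≤ B`,
killed by `a^j` ((L1) + Shapiro, `BigRepLocalInvariants`); the `M_{g_m}` `a`-primary with `a`-divisible
local invariants at the other constrained places; `a^j ∣ (C ϖ)^k`; the congruences (b) `θ_m`, (c) at `Σ`
(`hc`) and once more at one level in printed shape (`hc₀`, ramified constants, split Euler factors,
Hsieh's `ϖ ∤ L(g_{m₀})`); (2.5) `hCh`; Σ-removal `hLS`/`hP`/`hSig`; torsion + no finite submodules.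
Conclusion **`Ch_Λ(X₀) ⊆ (L)`**. Pure algebra on abstract data; CONDITIONAL on nothing; books nothing.
[cite: Castella2018Erratum, proof of Thm. 1.1, (c) and footnote 1 (p. 4), read one-sidedly and without (iv)]
[cite: Castella2018, (3.1)] [cite: Hsieh2014, Thm. B] -/
theorem charIdeal_le_of_selmer_congruences_fLocal_printed_mixed (hv₀ : v₀ ∈ L₀)
    (a : PowerSeries 𝒪) (ha : Ideal.span {a} ≤ (⊥ : Ideal (PowerSeries 𝒪)).jacobson)
    {Mf : Type} [AddCommGroup Mf] [Module (PowerSeries 𝒪) Mf] [TopologicalSpace Mf]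
    [DiscreteTopology Mf] [ContinuousSMul (PowerSeries 𝒪) Mf] (ρf : ContinuousRep Γ₀ (PowerSeries 𝒪) Mf)
    (hdivf : Function.Surjective fun x : Mf => a • x) (h0f : ρf.toTopRep.ρ.invariants = ⊥)
    (Mg : ℕ → Type) [∀ m, AddCommGroup (Mg m)] [∀ m, Module (PowerSeries 𝒪) (Mg m)]
    [∀ m, TopologicalSpace (Mg m)] [∀ m, DiscreteTopology (Mg m)]
    [∀ m, ContinuousSMul (PowerSeries 𝒪) (Mg m)] (ρg : ∀ m, ContinuousRep Γ₀ (PowerSeries 𝒪) (Mg m))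
    (hdivg : ∀ m, Function.Surjective fun x : Mg m => a • x)
    (h0g : ∀ m, (ρg m).toTopRep.ρ.invariants = ⊥)
    (hprim : ∀ m (w : Mg m), ∃ n : ℕ, a ^ n • w = 0)
    (hdivL : ∀ m, ∀ v ∈ L₀, v ≠ v₀ → ∀ w : Mg m, w ∈ (((ρg m).restrict (ψ v)).toTopRep).ρ.invariants →
      ∃ w' ∈ (((ρg m).restrict (ψ v)).toTopRep).ρ.invariants, a • w' = w)
    (θ : ∀ m, 1 ≤ m → ((torsionRep (ρg m) (a ^ m)).toTopRep ≅ (torsionRep ρf (a ^ m)).toTopRep))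
    [Module.Finite (PowerSeries 𝒪) (CharacterModule (selmer ψ L₀ ρf))]
    [∀ m, Module.Finite (PowerSeries 𝒪) (CharacterModule (selmer ψ L₀ (ρg m)))]
    [Finite ((ρf.restrict (ψ v₀)).toTopRep).ρ.invariants]
    {M₀ : Type} [AddCommGroup M₀] [Module (PowerSeries 𝒪) M₀] [Module.Finite (PowerSeries 𝒪) M₀]
    {ϖ : 𝒪} (hϖ : Prime ϖ) {L LS P : PowerSeries 𝒪} (hLS : LS = L * P) (hP : P ≠ 0)
    (j k B : ℕ) (hjk : a ^ j ∣ PowerSeries.C ϖ ^ k) (Lm : ℕ → PowerSeries 𝒪)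
    (hkillf : ∀ w : Mf, w ∈ ((ρf.restrict (ψ v₀)).toTopRep).ρ.invariants → a ^ j • w = 0)
    (hBf : Nat.card ((ρf.restrict (ψ v₀)).toTopRep).ρ.invariants ≤ B)
    (hCh : ∀ m, 1 ≤ m → Module.IsTorsion (PowerSeries 𝒪) (CharacterModule (selmer ψ L₀ (ρg m))) →
      charIdeal (PowerSeries 𝒪) (CharacterModule (selmer ψ L₀ (ρg m))) ≤ Ideal.span {Lm m})
    (hc : ∀ m, 1 ≤ m →
      Ideal.span {Lm m} ⊔ (Ideal.span {a}) ^ m = Ideal.span {LS} ⊔ (Ideal.span {a}) ^ m)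
    (hTS : Module.IsTorsion (PowerSeries 𝒪) (CharacterModule (selmer ψ L₀ ρf)))
    (hnfS : ∀ N' : Submodule (PowerSeries 𝒪) (CharacterModule (selmer ψ L₀ ρf)),
      Module.length (PowerSeries 𝒪) N' ≠ ⊤ → N' = ⊥)
    (hT₀ : Module.IsTorsion (PowerSeries 𝒪) M₀)
    (hnf₀ : ∀ N' : Submodule (PowerSeries 𝒪) M₀, Module.length (PowerSeries 𝒪) N' ≠ ⊤ → N' = ⊥)
    (hSig : charIdeal (PowerSeries 𝒪) M₀ * Ideal.span {P} ≤
      charIdeal (PowerSeries 𝒪) (CharacterModule (selmer ψ L₀ ρf)))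
    {Lm₀ C Cm u : PowerSeries 𝒪} {t : ℕ} {J : Ideal (PowerSeries 𝒪)}
    {ι : Type*} (S : Finset ι) (Q Qm : ι → Polynomial 𝒪) (z zm : ι → PowerSeries 𝒪)
    (hc₀ : Ideal.span {Lm₀ * Cm * ∏ i ∈ S, Polynomial.aeval (zm i) (Qm i)} ⊔ J =
      Ideal.span {L * C * ∏ i ∈ S, Polynomial.aeval (z i) (Q i)} ⊔ J)
    (hJ : J ≤ Ideal.span {PowerSeries.C ϖ ^ (t + 1)})
    (hCm : Cm = PowerSeries.C ϖ ^ t * u) (hu : ¬ PowerSeries.C ϖ ∣ u) (hC : PowerSeries.C ϖ ^ t ∣ C)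
    (hQ : ∀ i ∈ S, ¬ ϖ ∣ (Qm i).coeff 0)
    (hz : ∀ i ∈ S, PowerSeries.map (Ideal.Quotient.mk (Ideal.span {ϖ})) (zm i) ≠
      PowerSeries.C (PowerSeries.constantCoeff
        (PowerSeries.map (Ideal.Quotient.mk (Ideal.span {ϖ})) (zm i))))
    (hLm₀ : ¬ PowerSeries.C ϖ ∣ Lm₀) :
    charIdeal (PowerSeries 𝒪) M₀ ≤ Ideal.span {L} := by
  -- re-indexed family `m ↦ g_{m+j+1}` with (b) restricted, local data at `v₀` from the `f`-side
  have hdvd : ∀ m : ℕ, a ^ m ∣ a ^ (m + j + 1) := fun m => pow_dvd_pow a (by omega)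
  let θ' : ∀ m : ℕ, 1 ≤ m →
      ((torsionRep (ρg (m + j + 1)) (a ^ m)).toTopRep ≅ (torsionRep ρf (a ^ m)).toTopRep) :=
    fun m _ => (nonempty_torsionIso_of_dvd (ρg (m + j + 1)) ρf (hdvd m) (θ (m + j + 1) (by omega))).some
  have hloc : ∀ m : ℕ, Finite (((ρg (m + j + 1)).restrict (ψ v₀)).toTopRep).ρ.invariants ∧
      Nat.card (((ρg (m + j + 1)).restrict (ψ v₀)).toTopRep).ρ.invariants ≤
        Nat.card ((ρf.restrict (ψ v₀)).toTopRep).ρ.invariants := fun m =>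
    finite_and_natCard_invariants_le_of_iso (ψ v₀) ρf (ρg (m + j + 1)) a (j := j) (m := m + j + 1)
      (by omega) (θ (m + j + 1) (by omega)) (hprim (m + j + 1)) hkillf
  haveI : ∀ m, Finite (((ρg (m + j + 1)).restrict (ψ v₀)).toTopRep).ρ.invariants := fun m => (hloc m).1
  refine charIdeal_le_of_selmer_congruences_finite_localInvariants_mixed_imprimitive ψ L₀ v₀ hv₀ a ha ρf
    hdivf h0f (fun m => Mg (m + j + 1)) (fun m => ρg (m + j + 1)) (fun m => hdivg (m + j + 1))
    (fun m => h0g (m + j + 1)) θ' (prime_C_of_prime hϖ)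
    (not_C_dvd_of_printed_congruence hϖ S Q Qm z zm hc₀ hJ hCm hu hC hQ hz hLm₀) hLS hP k B
    (fun m => Lm (m + j + 1)) (fun m w hw => ?_) (fun m => hdivL (m + j + 1))
    (fun m => (hloc m).2.trans hBf) (fun m _ => hCh (m + j + 1) (by omega)) (fun m _ => ?_)
    hTS hnfS hT₀ hnf₀ hSig
  · obtain ⟨s, hs⟩ := hjk
    have hj : a ^ j • w = 0 :=
      smul_pow_eq_zero_of_mem_invariants_of_iso (ψ v₀) ρf (ρg (m + j + 1)) a (j := j) (m := m + j + 1)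
        (by omega) (θ (m + j + 1) (by omega)) (hprim (m + j + 1)) hkillf hw
    rw [hs, mul_comm, mul_smul, hj, smul_zero]
  · have hle : (Ideal.span {a}) ^ (m + j + 1) ≤ (Ideal.span {a}) ^ m :=
      Ideal.pow_le_pow_right (by omega)
    have h := hc (m + j + 1) (by omega)
    calc Ideal.span {Lm (m + j + 1)} ⊔ Ideal.span {a} ^ m
        = Ideal.span {Lm (m + j + 1)} ⊔ Ideal.span {a} ^ (m + j + 1) ⊔ Ideal.span {a} ^ m := by
          rw [sup_assoc, sup_eq_right.mpr hle]
      _ = Ideal.span {LS} ⊔ Ideal.span {a} ^ (m + j + 1) ⊔ Ideal.span {a} ^ m := by rw [h]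
      _ = Ideal.span {LS} ⊔ Ideal.span {a} ^ m := by rw [sup_assoc, sup_eq_right.mpr hle]

end Summit.BirchSwinnertonDyer.BirchSwinnertonDyer.Theorems.SelmerDefectAssemblyMixed

end
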